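import Mathlib.CategoryTheory.Limits.Shapes.IsTerminal
import Mathlib.Topology.Algebra.Category.ProfiniteGrp.Basic
import Literature.AlgebraicGeometry.Frobenioids.Categories
import Literature.AlgebraicGeometry.Frobenioids.CategoriesFactorization
import Literature.AlgebraicGeometry.Frobenioids.ModelFrobenioid
import Literature.IUT.HodgeTheaters.Conventions
import HarnessLib

/-!
# [IUTchI] Example 5.1 (ii)–(iv), (vi): the global Frobenioids `†ℱ^⊛ ⊇ †ℱ^⊚`, `†ℱ^⊛_mod`

Mochizuki, *Inter-universal Teichmüller theory I*, §5, Example 5.1 "Global Frobenioids", parts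
(ii)–(iv) and (vi), kurims manuscript (May 2020) pp. 125–126, 130 ([IUTchI] Ex 5.1 (ii)–(iv),(vi)
pp.125–130) [claim: Mochizuki2012, status: disputed].  STATEMENTS-FIRST; nothing asserted.

**(ii) (p. 125).**  The field structure on `𝕄̄^⊛(†𝒟^⊚)` gives the valuations `𝕍(†𝒟^⊚)` ("`𝕍(F̄)`")
with `π₁(†𝒟^⊛)`-action, hence the monoid `Φ^⊛(†𝒟^⊚)(−)` on `†𝒟^⊛` ([FrdI] Def 1.1 (ii)) of
stack-theoretic arithmetic divisors on the subfields `𝕄̄^⊛(†𝒟^⊚)^A` ([FrdI] Ex 6.3; Rmk 3.1.5), the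
natural `𝕄^⊛(†𝒟^⊚)^A → Φ^⊛(†𝒟^⊚)(A)^gp`, and so, by [FrdI] Thm 5.2 (ii), a MODEL FROBENIOID
`ℱ^⊛(†𝒟^⊚)` over `†𝒟^⊛`.  **(iii) (p. 125–126).**  `†ℱ^⊛` := any category equivalent to `ℱ^⊛(†𝒟^⊚)`,
with its natural Frobenioid structure and base category `Base(†ℱ^⊛)`, together with a morphism
`†𝒟^⊚ → Base(†ℱ^⊛)` ABSTRACTLY EQUIVALENT (§0) to the natural `†𝒟^⊚ → †𝒟^⊛`; the resulting
isomorphism `Base(†ℱ^⊛) ⥲ †𝒟^⊛` is used to identify the two; `†ℱ^⊚ := †ℱ^⊛|_{†𝒟^⊚}`,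
`†ℱ^⊛_mod := †ℱ^⊛|_{terminal objects}` ("arithmetic line bundles on the stack `S_mod`").
**(iv) (p. 126).**  Birationalizations ([FrdI] Cor 4.10) `†ℱ^{⊚birat}, †ℱ^{⊛birat}, †ℱ^{⊛birat}_mod`;
`𝒪^×(A^birat)` = the multiplicative group of the number field of `A`; the pair
`π₁(†𝒟^⊛) ↷ 𝒪̃^⊛×` from Frobenius-trivial objects over Galois objects; the integral submonoids
`𝒪^⊿_𝔭 ⊆ 𝒪^×(A^birat)` for `𝔭 ∈ Prime(Φ_{†ℱ^⊛}(A))`; the decomposition groups `Π_{𝔭₀} ⊆ π₁(†𝒟^⊛)`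
(`𝔭₀` nonarchimedean iff `cd_p Π_{𝔭₀} = 3` for infinitely many `p`).  **(vi) (p. 130).**  The same
for `†ℱ^⊚, †𝒟^⊚` ("routine details left to the reader").

**Typing.**  `†𝒟^⊛ := ℬ(π₁(†𝒟^⊛))⁰` is REAL: the connected part (tree's [FrdI] §0 `ConnectedPart`) of
the tree's `BCat` (finite continuous `π₁`-sets).  The divisor-monoid data `(Φ^⊛, 𝔹, Div)` on it is
DATA (`GlobalDivisorData`; TODO-merge:abc-iut-L1-t3 — the [FrdI] Ex 6.3 functor, whose fibrewise
values are the tree's `EffArithDivisor`/`principalArithDivisorHom`), and then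
`ℱ^⊛(†𝒟^⊚) := ModelFrobenioid Φ^⊛ 𝔹 Div` is the tree's REAL [FrdI] Thm 5.2 (i) category.  `†ℱ^⊛` is a
structure (`GlobalFrobenioid`): a category with an equivalence to `ℱ^⊛(†𝒟^⊚)`, its base functor
(DATA standing for the category-theoretic base of [FrdI] Thm 3.4/Cor 4.11, TODO-merge
abc-iut-L1-t3), the given `†𝒟^⊚ → Base`, and a WITNESS of abstract equivalence from which
`AbstractlyEquivalent` (tree, §0) is proved; `†ℱ^⊚` is REAL as the [FrdI] §0 categorical fibre product
(tree's `CFP`), `†ℱ^⊛_mod` REAL as a full subcategory.  Part (iv) is the DATA structure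
`BirationalData` (the birationalization functor of [FrdI] Cor 4.10 is abc-iut-L1-t3's;
cohomological dimension is not in Mathlib, so the `cd`-criterion is recorded, not typed).
Deliberately NOT here: parts (i) [`GlobalFrobenioids.lean`], (v), (vii) and the Remarks
[`GlobalFrobenioidsKummer.lean`]; Remark 5.1.2 ("the constructions of Example 5.1 manifestly only
require the `𝒟`-NF-bridge portion `†φ^NF_⋇`") is reflected by the INPUT of these files being
`π₁(†𝒟^⊚)`-level data only.  No printed statement is strengthened; no side is taken.
-/

namespace Literature.IUT.HodgeTheaters

open CategoryTheory Literature.AlgebraicGeometry.Frobenioids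

universe w v u

/-! ### `†𝒟^⊛` and the divisor data (Ex. 5.1 (i)/(ii), pp. 123, 125) -/

/-- `†𝒟^⊛ := ℬ(π₁(†𝒟^⊛))⁰`: the connected finite sets with continuous `π₁(†𝒟^⊛)`-action (p. 123,
"write `†𝒟^⊛` for `ℬ(−)⁰` of this profinite group").  ([IUTchI] Ex 5.1 (i) p.123)
[claim: Mochizuki2012, status: disputed] -/
abbrev BaseCat (G : ProfiniteGrp.{u}) : Type (u + 1) := ConnectedPart (BCat G)

/-- INTERFACE DATA for Ex. 5.1 (ii) (p. 125): the monoid `Φ^⊛(†𝒟^⊚)(−)` on `†𝒟^⊛` of stack-theoretic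
arithmetic divisors, the rational-function monoid `A ↦ 𝕄^⊛(†𝒟^⊚)^A` and the natural
`𝕄^⊛(†𝒟^⊚)^A → Φ^⊛(†𝒟^⊚)(A)^gp` — in the tree's [FrdI] Thm 5.2 encoding (`Dᵒᵖ ⥤ CommMonCat`,
multiplicative).  TODO-merge:abc-iut-L1-t3 ([FrdI] Ex 6.3 functor over `EffArithDivisor`).
([IUTchI] Ex 5.1 (ii) p.125) [claim: Mochizuki2012, status: disputed] -/
structure GlobalDivisorData (G : ProfiniteGrp.{u}) : Type (u + 1) where
  /-- `Φ^⊛(†𝒟^⊚)` -/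
  Φ : (BaseCat G)ᵒᵖ ⥤ CommMonCat.{u}
  /-- `A ↦ 𝕄^⊛(†𝒟^⊚)^A` -/
  B : (BaseCat G)ᵒᵖ ⥤ CommMonCat.{u}
  /-- `𝕄^⊛(†𝒟^⊚)^A → Φ^⊛(†𝒟^⊚)(A)^gp` -/
  div : B ⟶ monoidGp Φ

namespace GlobalDivisorData

variable {G : ProfiniteGrp.{u}} (Δ : GlobalDivisorData G)

/-- `ℱ^⊛(†𝒟^⊚)`: the model Frobenioid over `†𝒟^⊛` determined by the divisor data ([FrdI] Thm 5.2, as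
in [FrdI] Ex 6.3; p. 125) — the tree's `ModelFrobenioid`. ([IUTchI] Ex 5.1 (ii) p.125)
[claim: Mochizuki2012, status: disputed] -/
abbrev ModelGlobalFrobenioid : Type (u + 1) := ModelFrobenioid Δ.Φ Δ.B Δ.div

/-- The projection `ℱ^⊛(†𝒟^⊚) → †𝒟^⊛`. ([IUTchI] Ex 5.1 (ii) p.125) [claim: Mochizuki2012, status: disputed] -/
noncomputable abbrev modelBase : Δ.ModelGlobalFrobenioid ⥤ BaseCat G :=
  ModelFrobenioid.baseFunctor Δ.Φ Δ.B Δ.div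

end GlobalDivisorData

/-! ### `†ℱ^⊛`, `†ℱ^⊚`, `†ℱ^⊛_mod` (Ex. 5.1 (iii), pp. 125–126) -/

/-- **Ex. 5.1 (iii)** (pp. 125–126): a *global Frobenioid* `†ℱ^⊛` — "any category equivalent to
`ℱ^⊛(†𝒟^⊚)`", with [the base functor of] its natural Frobenioid structure, "a morphism
`†𝒟^⊚ → Base(†ℱ^⊛)` which is abstractly equivalent to the natural morphism `†𝒟^⊚ → †𝒟^⊛`", and the
resulting identification `Base(†ℱ^⊛) ⥲ †𝒟^⊛` (recorded as the witnessing equivalences `α₁`,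
`identify` with the compatibility isomorphism).  `Dcirc`/`toBase0` stand for `†𝒟^⊚ → †𝒟^⊛`
(TODO-merge:abc-iut-L5-t3 Def 4.1 (v)); `Base`/`toBase` for the category-theoretic base of [FrdI]
Cor 4.11 (TODO-merge:abc-iut-L1-t3). ([IUTchI] Ex 5.1 (iii) p.125) [claim: Mochizuki2012, status: disputed] -/
structure GlobalFrobenioid {G : ProfiniteGrp.{u}} (Δ : GlobalDivisorData G)
    (Dcirc : Type (u + 1)) [Category.{u} Dcirc] (toBase0 : Dcirc ⥤ BaseCat G) :
    Type (u + 2) where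
  /-- the category `†ℱ^⊛` -/
  cat : Type (u + 1)
  [catCategory : Category.{u + 1} cat]
  /-- "equivalent to `ℱ^⊛(†𝒟^⊚)`" -/
  equiv : cat ≌ Δ.ModelGlobalFrobenioid
  /-- `Base(†ℱ^⊛)` and the base functor of the Frobenioid structure -/
  Base : Type (u + 1)
  [baseCategory : Category.{u} Base]
  toBase : cat ⥤ Base
  /-- the given morphism `†𝒟^⊚ → Base(†ℱ^⊛)` -/
  baseMor : Dcirc ⥤ Base
  /-- witnesses of "abstractly equivalent to `†𝒟^⊚ → †𝒟^⊛`": `α₁ : †𝒟^⊚ ⥲ †𝒟^⊚`,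
  `identify : Base(†ℱ^⊛) ⥲ †𝒟^⊛`, `compat : identify ∘ baseMor ≅ toBase0 ∘ α₁` -/
  α₁ : Dcirc ≌ Dcirc
  identify : Base ≌ BaseCat G
  compat : α₁.functor ⋙ toBase0 ≅ baseMor ⋙ identify.functor
  /-- the identification is compatible with the equivalence to the model: `Base(A) = Base(equiv A)` -/
  toBase_compat : toBase ⋙ identify.functor ≅ equiv.functor ⋙ Δ.modelBase

namespace GlobalFrobenioid

variable {G : ProfiniteGrp.{u}} {Δ : GlobalDivisorData G} {Dcirc : Type (u + 1)}
  [Category.{u} Dcirc] {toBase0 : Dcirc ⥤ BaseCat G} (F : GlobalFrobenioid Δ Dcirc toBase0)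

attribute [instance] catCategory baseCategory

/-- The given `†𝒟^⊚ → Base(†ℱ^⊛)` IS abstractly equivalent (§0) to `†𝒟^⊚ → †𝒟^⊛`, from the recorded
witnesses. ([IUTchI] Ex 5.1 (iii) p.125) [claim: Mochizuki2012, status: disputed] -/
theorem abstractlyEquivalent_baseMor : AbstractlyEquivalent F.baseMor toBase0 :=
  ⟨F.α₁, F.identify, ⟨F.compat⟩⟩

/-- `†ℱ^⊚ := †ℱ^⊛|_{†𝒟^⊚}`, "the restriction of `†ℱ^⊛` to `†𝒟^⊚` via the natural morphism `†𝒟^⊚ → †𝒟^⊛`"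
(pp. 125–126), typed as the [FrdI] §0 categorical fibre product `†ℱ^⊛ ×_{Base(†ℱ^⊛)} †𝒟^⊚` (tree's
`CFP`). ([IUTchI] Ex 5.1 (iii) p.125) [claim: Mochizuki2012, status: disputed] -/
abbrev Fcirc : Type (u + 1) := CFP F.toBase F.baseMor

/-- The base functor `†ℱ^⊚ → †𝒟^⊚`. ([IUTchI] Ex 5.1 (iii) p.126) [claim: Mochizuki2012, status: disputed] -/
abbrev fcircBase : F.Fcirc ⥤ Dcirc := CFP.proj₂ F.toBase F.baseMor

/-- The inclusion functor `†ℱ^⊚ → †ℱ^⊛` ("`(→ †ℱ^⊛)`", p. 125). ([IUTchI] Ex 5.1 (iii) p.125)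
[claim: Mochizuki2012, status: disputed] -/
abbrev fcircIncl : F.Fcirc ⥤ F.cat := CFP.proj₁ F.toBase F.baseMor

/-- The objects of `†ℱ^⊛` lying over terminal objects of `†𝒟^⊛` [i.e. over "`C_{F_mod}`"].
([IUTchI] Ex 5.1 (iii) p.126) [claim: Mochizuki2012, status: disputed] -/
def overTerminal : ObjectProperty F.cat := fun A =>
  Nonempty (Limits.IsTerminal (F.identify.functor.obj (F.toBase.obj A)))

/-- `†ℱ^⊛_mod := †ℱ^⊛|_{terminal objects}`, "the restriction of `†ℱ^⊛` to the full subcategory of `†𝒟^⊛`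
determined by the terminal objects" — "the Frobenioid of arithmetic line bundles on the stack
`S_mod`" (p. 126). ([IUTchI] Ex 5.1 (iii) p.126) [claim: Mochizuki2012, status: disputed] -/
abbrev Fmod : Type (u + 1) := F.overTerminal.FullSubcategory

/-- The embedding `†ℱ^⊛_mod ↪ †ℱ^⊛` (Rmk 5.1.3: "the natural embedding `†ℱ^⊛_mod ↪ †ℱ^⊛`").
([IUTchI] Ex 5.1 (iii) p.126) [claim: Mochizuki2012, status: disputed] -/
abbrev fmodIncl : F.Fmod ⥤ F.cat := F.overTerminal.ι

end GlobalFrobenioid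

/-! ### Birationalizations and decomposition groups (Ex. 5.1 (iv), p. 126) -/

/-- INTERFACE DATA for Ex. 5.1 (iv) (p. 126), for a global Frobenioid `†ℱ^⊛` over `π₁(†𝒟^⊛) = G`: the
pair `π₁(†𝒟^⊛) ↷ 𝒪̃^⊛×` [topological group acting continuously on a discrete abelian group] obtained
from `𝒪^×(A^birat)` for Frobenius-trivial `A` over Galois objects ("considered up to inner
automorphisms of the pair"); an index set of primes `𝔭` [of the divisor monoids `Φ_{†ℱ^⊛}(A)`] with
the integral submonoids `𝒪^⊿_𝔭 ⊆ 𝒪̃^⊛×` ("integral elements with respect to the valuation determined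
by `𝔭`") and their unit groups `𝒪^×_𝔭`; the primes `𝔭₀` over terminal objects with their
decomposition groups `Π_{𝔭₀} ⊆ π₁(†𝒟^⊛)` ("simply the decomposition group associated to some
`v ∈ 𝕍_mod`"), each `𝔭` lying over some `𝔭₀`, and the nonarchimedean ones [text: `𝔭₀` is
nonarchimedean iff `cd_p(Π_{𝔭₀}) = 2 + 1 = 3` for infinitely many primes `p`; cohomological
dimension is not available in Mathlib, so this criterion is carried as the flag `IsNonarch`].
TODO-merge:abc-iut-L1-t3 ([FrdI] Cor 4.10 birationalization, Prop 4.4 (iii)).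
([IUTchI] Ex 5.1 (iv) p.126) [claim: Mochizuki2012, status: disputed] -/
structure BirationalData (G : ProfiniteGrp.{u}) : Type (u + 1) where
  /-- `𝒪̃^⊛×` with its continuous `π₁(†𝒟^⊛)`-action -/
  Otilde : Type u
  [otildeGroup : CommGroup Otilde]
  [otildeAction : MulDistribMulAction G Otilde]
  isOpen_stabilizer : ∀ x : Otilde, IsOpen (MulAction.stabilizer G x : Set G)
  /-- the primes `𝔭` with `𝒪^⊿_𝔭 ⊆ 𝒪̃^⊛×` -/
  PrimeIdx : Type u
  Oint : PrimeIdx → Submonoid Otilde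
  /-- the primes `𝔭₀` over terminal objects, `𝔭 ↦ 𝔭₀`, decomposition groups `Π_{𝔭₀}`, and the
  nonarchimedean flag -/
  PrimeIdx0 : Type u
  over : PrimeIdx → PrimeIdx0
  decomp : PrimeIdx0 → Subgroup G
  IsNonarch : PrimeIdx0 → Prop

namespace BirationalData

variable {G : ProfiniteGrp.{u}} (β : BirationalData G)

attribute [instance] otildeGroup otildeAction

/-- `𝒪^×_𝔭 ⊆ 𝒪^⊿_𝔭`, "the submonoid of invertible elements" (p. 126). ([IUTchI] Ex 5.1 (iv) p.126)
[claim: Mochizuki2012, status: disputed] -/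
def Ounits (p : β.PrimeIdx) : Subgroup β.Otilde where
  carrier := {x | x ∈ β.Oint p ∧ x⁻¹ ∈ β.Oint p}
  one_mem' := ⟨(β.Oint p).one_mem, by simp⟩
  mul_mem' := fun {a b} ha hb =>
    ⟨(β.Oint p).mul_mem ha.1 hb.1, by rw [mul_inv]; exact (β.Oint p).mul_mem ha.2 hb.2⟩
  inv_mem' := fun {a} ha => ⟨ha.2, by simpa using ha.1⟩

/-- `𝒪^×_𝔭 ≤ 𝒪^⊿_𝔭`. ([IUTchI] Ex 5.1 (iv) p.126) [claim: Mochizuki2012, status: disputed] -/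
theorem ounits_le (p : β.PrimeIdx) : ((β.Ounits p : Subgroup β.Otilde) : Set β.Otilde) ⊆ β.Oint p :=
  fun _ hx => hx.1

/-- The printed description of `Π_{𝔭₀}` (p. 126): "the elements of `Aut_{†ℱ^⊛}(A)` that fix the submonoid
`𝒪^⊿_𝔭`, for some system of `𝔭`'s lying over `𝔭₀`" — typed as: `Π_{𝔭₀}` is the stabiliser of
`𝒪^⊿_𝔭` for some `𝔭` over `𝔭₀`.  A predicate on the data, not asserted. ([IUTchI] Ex 5.1 (iv) p.126)
[claim: Mochizuki2012, status: disputed] -/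
@[mk_iff] structure DecompIsStabilizer : Prop where
  out : ∀ p0 : β.PrimeIdx0, ∃ p : β.PrimeIdx, β.over p = p0 ∧
    ∀ g : G, g ∈ β.decomp p0 ↔ ∀ x : β.Otilde, x ∈ β.Oint p ↔ g • x ∈ β.Oint p

end BirationalData

end Literature.IUT.HodgeTheaters
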